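import Mathlib
import HarnessLib
import Summits.NavierStokesRegularity.NavierStokesRegularity.Theorems.PoloidalWindowDoorLrcModEntireSonicSheetStrainPackage
import Summits.NavierStokesRegularity.NavierStokesRegularity.Theorems.PoloidalWindowDoorLrcModEntireSonicSheetFrequency

/-!
# Route `PoloidalWindowDoor`, item `LrcModEntire` (stmt-NavierStokesRegularity-20428), cell (Q4-sonic, straight, μ < 0) `stub_Q4sonicLineNeg`, case I —
# THE TIME WINDOW OF THE SHEET DATA: ON AN OPEN INTERVAL OF TIMES THE STRAIN ROW IS EITHER IDENTICALLY `s`-FREE OR PERIODIC WITH ONE PERIOD (S3(f) + the S5 hand-over)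

Cell ns-regularity-ideate, stub-worker seat ns-poloidal-K2-p2 g17 under the LEAD of item 20428 (ns-poloidal-K2-p3 g17, PICK 2026-08-29T20:07:35Z «OUTPUT (S5) …: on
an open τ-interval J either P = Q = 0 on {m = 0} or the sheet functions are L-periodic in s»); `--supports stmt-NavierStokesRegularity-20428 --as helper`.
Assembly of `…SonicSheetStrainPackage.sheet_strain_dichotomy_of_package` (dichotomy at each sonic time) with `…SonicSheetFrequency.locked_frequency`, the
uniform-in-`s` time-Lipschitz bound of the cross strain coming from the CLASS bounds (`exists_norm_iteratedFDeriv_le_of_typeI` (D²U),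
`exists_lipschitz_time_of_typeI` (DU) on the window `[−3/2, −1/2)`, mean value inequality).

* `eq_of_frame_components` — two vectors with the same `e`-, `Je`- and vertical components are equal (`e` horizontal unit);
* `crossStrain_contDiffOn` — `(τ,s) ↦ S_eν(τ;s,0) = ⟪DU(−1+τ)(W_τ(s,0))e, Je⟫` is `C^∞` on the strip `|τ| < δ′` (joint smoothness of the class);
* `crossStrain_lipschitz` — `|S_eν(τ′;s,0) − S_eν(τ;s,0)| ≤ M(τ)|τ′ − τ|` near `τ`, one `M(τ)` for all `s`;
* ★★ `sheet_strain_window` — hypotheses: class `U`, `σ = ±1`, (TH) slab law (`C³` slope), horizontal unit `e`, the OUTPUT BLOCK `hpack` of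
  `…Q4TimeWebPackage.time_web_package_line` on `δ′` (`0 < δ′ ≤ ρ`, `δ′ < 1/2`), CASE I on the box (`R(τ,·)` affine for every `|τ| < δ′`), PARALLEL WEBS on the box
  (K2-p2's B-T), `μ(−1+τ, z) < 0` on the box.  CONCLUSION: there are `τ₁ < τ₂` in `[−δ′, δ′]` such that on `J = (τ₁, τ₂)` EITHER
  (s-FREE) `⟪DU(−1+τ)(W)e, e⟫ = ⟪DU(−1+τ)(W)e, Je⟫ = 0` at every web point `W = frameCLM e (s, n₀(τ,s,z), z)`, `|z| < δ′`, for EVERY `τ ∈ J` — the data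
  `P = Q = 0` on `{m = 0}` of T2B-g17 §8(8a) — OR (PERIODIC) there is ONE `L > 0` with `U(−1+τ, W_τ(s+L,z)) = U(−1+τ, W_τ(s,z))` for every `τ ∈ J`, `s`, `|z| < δ′`
  (so the differences `U(·,·+Le) − U` vanish on the web sheet over `J`, §8(8b)); `J` need not contain `0` (`…HorizontalGermAtTime` / `…HorizontalPeriodAtTime`).

WHAT THIS IS NOT: not a claim about Navier–Stokes regularity and not a stub of the registry — S3(f)/S5 bookkeeping of the case-I chain of the research slot
`stub_Q4sonicLineNeg` (registry twist_split v13); no stub is closed here; items 20428 / 19708 / 27893 OPEN (bears_on LADDER-NS N0).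
-/

noncomputable section

set_option linter.dupNamespace false
set_option linter.style.longLine false

namespace Summit.NavierStokesRegularity.NavierStokesRegularity.Theorems.PoloidalWindowDoorLrcModEntireSonicSheetStrainWindow

open Set Function Filter Topology Metric Asymptotics
open scoped RealInnerProductSpace InnerProductSpace ContDiff
open Literature.Analysis Literature.Analysis.FluidPDE Literature.Analysis.UnboundedOperators
open Summit.NavierStokesRegularity.NavierStokesRegularity.Theorems
open Summit.NavierStokesRegularity.NavierStokesRegularity.Theorems.LocalSineTubeDoorProfileAlignedWindowRigidityAncient
open Summit.NavierStokesRegularity.NavierStokesRegularity.Theorems.PoloidalWindowDoorPoloidalWindowRigidityWindow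
open Summit.NavierStokesRegularity.NavierStokesRegularity.Theorems.PoloidalWindowDoorLrcModEntireSheetFlattenTools
open Summit.NavierStokesRegularity.NavierStokesRegularity.Theorems.PoloidalWindowDoorLrcModEntireParallelWebsIdentity
open Summit.NavierStokesRegularity.NavierStokesRegularity.Theorems.PoloidalWindowDoorLrcModEntireRidgeClassConstants
open Summit.NavierStokesRegularity.NavierStokesRegularity.Theorems.PoloidalWindowDoorLrcModEntireQ4SonicSheetCR
open Summit.NavierStokesRegularity.NavierStokesRegularity.Theorems.PoloidalWindowDoorLrcModEntireQ4SonicHotSheetTimeSplit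
open Summit.NavierStokesRegularity.NavierStokesRegularity.Theorems.PoloidalWindowDoorLrcModEntireSonicSheetTrig
open Summit.NavierStokesRegularity.NavierStokesRegularity.Theorems.PoloidalWindowDoorLrcModEntireSonicSheetStrainPackage
open Summit.NavierStokesRegularity.NavierStokesRegularity.Theorems.PoloidalWindowDoorLrcModEntireSonicSheetFrequency

/-- A vector is determined by its components along a horizontal unit vector `e`, along `Je`, and its height. -/
theorem eq_of_frame_components {e : EuclideanSpace ℝ (Fin 3)} (he2 : e 2 = 0) (hunit : e 0 ^ 2 + e 1 ^ 2 = 1) {x y : EuclideanSpace ℝ (Fin 3)}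
    (h1 : ⟪x, e⟫ = ⟪y, e⟫) (h2 : ⟪x, Jvec e⟫ = ⟪y, Jvec e⟫) (h3 : x 2 = y 2) : x = y := by
  rw [(inner_horizontal he2 x).1, (inner_horizontal he2 y).1] at h1
  rw [(inner_horizontal he2 x).2, (inner_horizontal he2 y).2] at h2
  have hx0 : x 0 = y 0 := by nlinarith [h1, h2, hunit, sq_nonneg (x 0 - y 0), sq_nonneg (x 1 - y 1)]
  have hx1 : x 1 = y 1 := by nlinarith [h1, h2, hunit, sq_nonneg (x 0 - y 0), sq_nonneg (x 1 - y 1)]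
  ext i
  fin_cases i
  · exact hx0
  · exact hx1
  · exact h3

variable {C : ℝ} {U : ℝ → EuclideanSpace ℝ (Fin 3) → EuclideanSpace ℝ (Fin 3)} {R μ : ℝ → ℝ → ℝ} {σ r ρ δ' : ℝ} {e : EuclideanSpace ℝ (Fin 3)}
  {n₀ : ℝ × ℝ × ℝ → ℝ} {κt : ℝ → ℝ → ℝ}

/-- Slice derivative = joint derivative in a spatial direction: `D(U(t,·))(x)[v] = D(uncurry U)(t,x)[(0,v)]`. -/
theorem fderiv_slice_eq_uncurry {t : ℝ} {x : EuclideanSpace ℝ (Fin 3)} (hW : DifferentiableAt ℝ (uncurry U) (t, x)) (v : EuclideanSpace ℝ (Fin 3)) :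
    fderiv ℝ (U t) x v = fderiv ℝ (uncurry U) (t, x) ((0 : ℝ), v) := by
  have h := hW.hasFDerivAt.comp x (hasFDerivAt_prodMk_right t x)
  rw [show (uncurry U ∘ Prod.mk t) = U t from rfl] at h
  rw [h.fderiv]
  simp

/-- **The cross strain on the sheet is jointly smooth in (τ, s).**  For the class profile and a web function `n₀` smooth at the points `(τ,s,0)`, `|τ| < δ′`
(`δ′ < 1/2`), the function `(τ,s) ↦ ⟪DU(−1+τ)(frameCLM e (s, n₀(τ,s,0), 0)) e, Je⟫` is `C^∞` on the strip `|τ| < δ′`. -/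
theorem crossStrain_contDiffOn (hrate : HasTypeITimeDecay C U) (hcont : ContinuousOn (uncurry U) (Iio (0 : ℝ) ×ˢ univ))
    (hmild : ∀ s t : ℝ, s < t → t < 0 → ∀ x, U t x = heatExtension (U s) (t - s) x - oseenDuhamel 1 s U U t x)
    (hdiv : ∀ t < 0, VectorCalculus.IsDivFree (U t)) (hδ'h : δ' < 1 / 2)
    (hn₀ : ∀ τ s : ℝ, |τ| < δ' → ContDiffAt ℝ ∞ n₀ (τ, s, (0 : ℝ))) :
    ContDiffOn ℝ ∞ (fun p : ℝ × ℝ => ⟪fderiv ℝ (U (-1 + p.1)) (frameCLM e (p.2, n₀ (p.1, p.2, (0 : ℝ)), (0 : ℝ))) e, Jvec e⟫) (Prod.fst ⁻¹' Ioo (-δ') δ' : Set (ℝ × ℝ)) := by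
  have hslab : ContDiffOn ℝ ∞ (uncurry U) (Iio (0 : ℝ) ×ˢ univ) := (isTypeIAncientMild_of_class hrate hcont hmild hdiv).1
  have hopen : IsOpen (Iio (0 : ℝ) ×ˢ (univ : Set (EuclideanSpace ℝ (Fin 3)))) := isOpen_Iio.prod isOpen_univ
  have hD : ContDiffOn ℝ ∞ (fderiv ℝ (uncurry U)) (Iio (0 : ℝ) ×ˢ univ) := hslab.fderiv_of_isOpen hopen (by simp)
  have hS : IsOpen (Prod.fst ⁻¹' Ioo (-δ') δ' : Set (ℝ × ℝ)) := isOpen_strip isOpen_Ioo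
  -- the map `p ↦ (−1 + p.1, frameCLM e (p.2, n₀(p.1,p.2,0), 0))` is smooth on the strip and lands in the slab
  have hX : ContDiffOn ℝ ∞ (fun p : ℝ × ℝ => ((-1 + p.1, frameCLM e (p.2, n₀ (p.1, p.2, (0 : ℝ)), (0 : ℝ))) : ℝ × EuclideanSpace ℝ (Fin 3)))
      (Prod.fst ⁻¹' Ioo (-δ') δ' : Set (ℝ × ℝ)) := by
    intro p hp
    have hτ : |p.1| < δ' := by
      have h := hp; simp only [mem_preimage, mem_Ioo] at h; exact abs_lt.2 ⟨h.1, h.2⟩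
    have hn : ContDiffAt ℝ ∞ (fun p : ℝ × ℝ => n₀ (p.1, p.2, (0 : ℝ))) p :=
      (hn₀ p.1 p.2 hτ).comp p (contDiffAt_fst.prodMk (contDiffAt_snd.prodMk contDiffAt_const))
    have hq : ContDiffAt ℝ ∞ (fun p : ℝ × ℝ => ((p.2, n₀ (p.1, p.2, (0 : ℝ)), (0 : ℝ)) : ℝ × ℝ × ℝ)) p :=
      contDiffAt_snd.prodMk (hn.prodMk contDiffAt_const)
    exact (((contDiffAt_const.add contDiffAt_fst).prodMk ((frameCLM e).contDiff.contDiffAt.comp p hq))).contDiffWithinAt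
  have hmaps : MapsTo (fun p : ℝ × ℝ => ((-1 + p.1, frameCLM e (p.2, n₀ (p.1, p.2, (0 : ℝ)), (0 : ℝ))) : ℝ × EuclideanSpace ℝ (Fin 3)))
      (Prod.fst ⁻¹' Ioo (-δ') δ' : Set (ℝ × ℝ)) (Iio (0 : ℝ) ×ˢ univ) := by
    intro p hp
    have h := hp; simp only [mem_preimage, mem_Ioo] at h
    refine ⟨?_, mem_univ _⟩
    show -1 + p.1 < 0
    linarith [h.2]
  have hcomp := hD.comp hX hmaps
  have happly : ContDiffOn ℝ ∞ (fun p : ℝ × ℝ => fderiv ℝ (uncurry U) (-1 + p.1, frameCLM e (p.2, n₀ (p.1, p.2, (0 : ℝ)), (0 : ℝ))) ((0 : ℝ), e))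
      (Prod.fst ⁻¹' Ioo (-δ') δ' : Set (ℝ × ℝ)) := hcomp.clm_apply contDiffOn_const
  have hinner : ContDiffOn ℝ ∞ (fun p : ℝ × ℝ => ⟪fderiv ℝ (uncurry U) (-1 + p.1, frameCLM e (p.2, n₀ (p.1, p.2, (0 : ℝ)), (0 : ℝ))) ((0 : ℝ), e), Jvec e⟫)
      (Prod.fst ⁻¹' Ioo (-δ') δ' : Set (ℝ × ℝ)) := happly.inner ℝ contDiffOn_const
  refine hinner.congr fun p hp => ?_
  have h := hp; simp only [mem_preimage, mem_Ioo] at h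
  have ht : -1 + p.1 < 0 := by linarith [h.2]
  have hmem : ((-1 + p.1, frameCLM e (p.2, n₀ (p.1, p.2, (0 : ℝ)), (0 : ℝ))) : ℝ × EuclideanSpace ℝ (Fin 3)) ∈ Iio (0 : ℝ) ×ˢ univ :=
    ⟨ht, mem_univ _⟩
  have hdiff : DifferentiableAt ℝ (uncurry U) (-1 + p.1, frameCLM e (p.2, n₀ (p.1, p.2, (0 : ℝ)), (0 : ℝ))) :=
    (hslab.contDiffAt (hopen.mem_nhds hmem)).differentiableAt (by simp)
  show ⟪fderiv ℝ (U (-1 + p.1)) (frameCLM e (p.2, n₀ (p.1, p.2, (0 : ℝ)), (0 : ℝ))) e, Jvec e⟫ =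
    ⟪fderiv ℝ (uncurry U) (-1 + p.1, frameCLM e (p.2, n₀ (p.1, p.2, (0 : ℝ)), (0 : ℝ))) ((0 : ℝ), e), Jvec e⟫
  rw [fderiv_slice_eq_uncurry hdiff]

/-- **Uniform-in-`s` time-Lipschitz bound for the cross strain** (class bounds): for `|τ| < δ′ < 1/2` there is `M ≥ 0` with
`|S_eν(τ′;s,0) − S_eν(τ;s,0)| ≤ M|τ′ − τ|` for `τ′` near `τ` and EVERY `s`, where `S_eν(τ;s,0) = ⟪DU(−1+τ)(s·e + n₀(τ,0,0)·Je)e, Je⟫`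
(the webs are parallel: `n₀(τ,s,0) = n₀(τ,0,0)`). -/
theorem crossStrain_lipschitz (hrate : HasTypeITimeDecay C U) (hcont : ContinuousOn (uncurry U) (Iio (0 : ℝ) ×ˢ univ))
    (hmild : ∀ s t : ℝ, s < t → t < 0 → ∀ x, U t x = heatExtension (U s) (t - s) x - oseenDuhamel 1 s U U t x)
    (hdiv : ∀ t < 0, VectorCalculus.IsDivFree (U t)) (hδ'h : δ' < 1 / 2)
    (hparN : ∀ τ' s z : ℝ, |τ'| < δ' → |z| < δ' → n₀ (τ', s, z) = n₀ (τ', (0 : ℝ), z))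
    (hn₀ : ∀ τ s : ℝ, |τ| < δ' → ContDiffAt ℝ ∞ n₀ (τ, s, (0 : ℝ)))
    {τ : ℝ} (hτ : |τ| < δ') :
    ∃ M : ℝ, 0 ≤ M ∧ ∀ s : ℝ, ∀ᶠ τ' in 𝓝 τ,
      |⟪fderiv ℝ (U (-1 + τ')) (frameCLM e (s, n₀ (τ', s, (0 : ℝ)), (0 : ℝ))) e, Jvec e⟫ -
        ⟪fderiv ℝ (U (-1 + τ)) (frameCLM e (s, n₀ (τ, s, (0 : ℝ)), (0 : ℝ))) e, Jvec e⟫| ≤ M * |τ' - τ| := by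
  have hδ' : 0 < δ' := lt_of_le_of_lt (abs_nonneg _) hτ
  have hab : (-2 : ℝ) < -1 / 2 := by norm_num
  have hb : (-1 / 2 : ℝ) < 0 := by norm_num
  have hhalf : (0 : ℝ) < 1 / 2 := by norm_num
  obtain ⟨K₂, hK₂⟩ := exists_norm_iteratedFDeriv_le_of_typeI C 2 hab hb hhalf
  obtain ⟨L₁, hL₁0, hL₁⟩ := exists_lipschitz_time_of_typeI C 1 hab hb hhalf
  have hwdiv := isWeaklyDivFree_of_class hrate hcont hmild hdiv
  have hwin : ∀ a : ℝ, |a| < δ' → -1 + a ∈ Ico (-2 + 1 / 2 : ℝ) (-1 / 2) := fun a ha => by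
    have h := abs_lt.1 (lt_trans ha hδ'h)
    exact ⟨by linarith [h.1], by linarith [h.2]⟩
  have hK₂' : ∀ a : ℝ, |a| < δ' → ∀ x, ‖iteratedFDeriv ℝ 2 (U (-1 + a)) x‖ ≤ K₂ := fun a ha x => hK₂ hcont hwdiv hmild hrate _ (hwin a ha) x
  have hK₂nn : 0 ≤ K₂ := le_trans (norm_nonneg _) (hK₂' τ hτ 0)
  -- local Lipschitz constant of `a ↦ n₀(a,0,0)` at `τ`
  have hnd : DifferentiableAt ℝ n₀ (τ, (0 : ℝ), (0 : ℝ)) := (hn₀ τ 0 hτ).differentiableAt (by simp)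
  have hnline : HasDerivAt (fun a : ℝ => n₀ (a, (0 : ℝ), (0 : ℝ))) (fderiv ℝ n₀ (τ, (0 : ℝ), (0 : ℝ)) ((1 : ℝ), (0 : ℝ), (0 : ℝ))) τ :=
    hnd.hasFDerivAt.comp_hasDerivAt τ (hasDerivAt_tauLine 0 0 τ)
  obtain ⟨c, hc, hcw⟩ := hnline.isBigO_sub.exists_pos
  have hcb := hcw.bound
  set M : ℝ := (L₁ * ‖e‖ + K₂ * ‖e‖ * (c * ‖Jvec e‖)) * ‖Jvec e‖ with hM
  refine ⟨M, by positivity, fun s => ?_⟩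
  have hopen : {a : ℝ | |a| < δ'} ∈ 𝓝 τ := (isOpen_lt continuous_abs continuous_const).mem_nhds hτ
  filter_upwards [hopen, hcb] with τ' hτ' hcτ'
  set t : ℝ := -1 + τ with ht
  set t' : ℝ := -1 + τ' with ht'
  set x : EuclideanSpace ℝ (Fin 3) := frameCLM e (s, n₀ (τ, s, (0 : ℝ)), (0 : ℝ)) with hx
  set x' : EuclideanSpace ℝ (Fin 3) := frameCLM e (s, n₀ (τ', s, (0 : ℝ)), (0 : ℝ)) with hx'
  have htt : t' - t = τ' - τ := by rw [ht, ht']; ring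
  -- smoothness of the two slices
  have hU : ∀ a : ℝ, |a| < δ' → ContDiff ℝ ∞ (U (-1 + a)) := fun a ha =>
    (analyticOnNhd_slice hcont (bdd_of_hasTypeITimeDecay hrate) hmild (by linarith [(abs_lt.1 (lt_trans ha hδ'h)).2])).contDiff
  -- (I) the time difference at the point `x'`
  have hI : ‖(fderiv ℝ (U t') x' - fderiv ℝ (U t) x') e‖ ≤ L₁ * |τ' - τ| * ‖e‖ := by
    have hL := hL₁ hcont hwdiv hmild hrate t (hwin τ hτ) t' (hwin τ' hτ') x'
    set D := iteratedFDeriv ℝ 1 (U t') x' - iteratedFDeriv ℝ 1 (U t) x' with hD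
    have happ : D ![e] = (fderiv ℝ (U t') x' - fderiv ℝ (U t) x') e := by
      simp [hD, iteratedFDeriv_one_apply]
    have hle := D.le_opNorm ![e]
    rw [happ] at hle
    have hprod : (∏ i : Fin 1, ‖(![e] : Fin 1 → EuclideanSpace ℝ (Fin 3)) i‖) = ‖e‖ := by simp
    rw [hprod] at hle
    rw [htt] at hL
    calc ‖(fderiv ℝ (U t') x' - fderiv ℝ (U t) x') e‖ ≤ ‖D‖ * ‖e‖ := hle
      _ ≤ L₁ * |τ' - τ| * ‖e‖ := mul_le_mul_of_nonneg_right hL (norm_nonneg _)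
  -- (II) the space difference at time `t`: mean value inequality for `y ↦ DU(t)(y)e`
  have hII : ‖(fderiv ℝ (U t) x' - fderiv ℝ (U t) x) e‖ ≤ K₂ * ‖e‖ * ‖x' - x‖ := by
    have hUt : ContDiff ℝ ∞ (U t) := hU τ hτ
    have hD1 : ContDiff ℝ ∞ (fderiv ℝ (U t)) := hUt.fderiv_right (m := ∞) (by norm_cast)
    have hφd : Differentiable ℝ (fun y => fderiv ℝ (U t) y e) := (hD1.differentiable (by simp)).clm_apply (differentiable_const e)
    have hbound : ∀ y : EuclideanSpace ℝ (Fin 3), ‖fderiv ℝ (fun y => fderiv ℝ (U t) y e) y‖ ≤ K₂ * ‖e‖ := by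
      intro y
      refine ContinuousLinearMap.opNorm_le_bound _ (by positivity) fun v => ?_
      have hDd : DifferentiableAt ℝ (fderiv ℝ (U t)) y := (hD1.differentiable (by simp)) y
      have heq : fderiv ℝ (fun y => fderiv ℝ (U t) y e) y v = fderiv ℝ (fderiv ℝ (U t)) y v e := by
        rw [fderiv_clm_apply hDd (differentiableAt_const e)]
        simp
      rw [heq]
      have h2 := (iteratedFDeriv ℝ 2 (U t) y).le_opNorm ![v, e]
      rw [iteratedFDeriv_two_apply] at h2
      simp only [Matrix.cons_val_zero, Matrix.cons_val_one, Fin.prod_univ_two] at h2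
      calc ‖fderiv ℝ (fderiv ℝ (U t)) y v e‖ ≤ ‖iteratedFDeriv ℝ 2 (U t) y‖ * (‖v‖ * ‖e‖) := h2
        _ ≤ K₂ * (‖v‖ * ‖e‖) := mul_le_mul_of_nonneg_right (hK₂' τ hτ y) (by positivity)
        _ = K₂ * ‖e‖ * ‖v‖ := by ring
    have hmv := (convex_univ (𝕜 := ℝ) (E := EuclideanSpace ℝ (Fin 3))).norm_image_sub_le_of_norm_fderiv_le (f := fun y => fderiv ℝ (U t) y e)
      (fun y _ => hφd y) (fun y _ => hbound y) (mem_univ x) (mem_univ x')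
    simpa only [sub_apply] using hmv
  -- the two points differ by `(n₀(τ',0,0) − n₀(τ,0,0))·Je`
  have hxx : ‖x' - x‖ ≤ c * |τ' - τ| * ‖Jvec e‖ := by
    have hdiff : x' - x = (n₀ (τ', (0 : ℝ), (0 : ℝ)) - n₀ (τ, (0 : ℝ), (0 : ℝ))) • Jvec e := by
      rw [hx, hx', frameCLM_apply, frameCLM_apply, hparN τ' s 0 hτ' (by simpa using hδ'), hparN τ s 0 hτ (by simpa using hδ')]
      simp only [sub_smul]; abel
    rw [hdiff, norm_smul]
    have hcτ'' : |n₀ (τ', (0 : ℝ), (0 : ℝ)) - n₀ (τ, (0 : ℝ), (0 : ℝ))| ≤ c * |τ' - τ| := by simpa [Real.norm_eq_abs] using hcτ'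
    exact mul_le_mul_of_nonneg_right (by simpa [Real.norm_eq_abs] using hcτ'') (norm_nonneg _)
  have hsplit : (fderiv ℝ (U t') x' - fderiv ℝ (U t) x) e = (fderiv ℝ (U t') x' - fderiv ℝ (U t) x') e + (fderiv ℝ (U t) x' - fderiv ℝ (U t) x) e := by
    simp only [sub_apply]; abel
  have hinner : ⟪fderiv ℝ (U t') x' e, Jvec e⟫ - ⟪fderiv ℝ (U t) x e, Jvec e⟫ = ⟪(fderiv ℝ (U t') x' - fderiv ℝ (U t) x) e, Jvec e⟫ := by
    rw [sub_apply, inner_sub_left]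
  rw [hinner]
  calc |⟪(fderiv ℝ (U t') x' - fderiv ℝ (U t) x) e, Jvec e⟫|
      ≤ ‖(fderiv ℝ (U t') x' - fderiv ℝ (U t) x) e‖ * ‖Jvec e‖ := abs_real_inner_le_norm _ _
    _ ≤ (‖(fderiv ℝ (U t') x' - fderiv ℝ (U t) x') e‖ + ‖(fderiv ℝ (U t) x' - fderiv ℝ (U t) x) e‖) * ‖Jvec e‖ := by
        rw [hsplit]; exact mul_le_mul_of_nonneg_right (norm_add_le _ _) (norm_nonneg _)
    _ ≤ (L₁ * |τ' - τ| * ‖e‖ + K₂ * ‖e‖ * (c * |τ' - τ| * ‖Jvec e‖)) * ‖Jvec e‖ :=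
        mul_le_mul_of_nonneg_right (add_le_add hI (hII.trans (mul_le_mul_of_nonneg_left hxx (by positivity)))) (norm_nonneg _)
    _ = M * |τ' - τ| := by rw [hM]; ring

/-- ★★ **THE TIME WINDOW OF THE SHEET DATA (S3(f) + S5 hand-over, T2B-g17 §7/§8).**  See the module docstring: on some open interval `J = (τ₁, τ₂) ⊂ [−δ′, δ′]`
EITHER the web-frame strain row vanishes on `Σ_τ` for every `τ ∈ J` (s-FREE: the data `P = Q = 0` on `{m = 0}`), OR ONE `L > 0` is an `s`-period of
`U(−1+τ)` along every web of `Σ_τ` for every `τ ∈ J` (PERIODIC). -/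
theorem sheet_strain_window
    (hrate : HasTypeITimeDecay C U) (hcont : ContinuousOn (uncurry U) (Iio (0 : ℝ) ×ˢ univ))
    (hmild : ∀ s t : ℝ, s < t → t < 0 → ∀ x, U t x = heatExtension (U s) (t - s) x - oseenDuhamel 1 s U U t x)
    (hdiv : ∀ t < 0, VectorCalculus.IsDivFree (U t))
    (hpol : ∀ s < 0, ∀ y, ⟪curl (U s) y, EuclideanSpace.single 2 1⟫_ℝ = 0)
    (hσ : σ = 1 ∨ σ = -1) (hμ3 : ContDiff ℝ 3 (uncurry μ))
    (hslabU : ∀ t : ℝ, |t + 1| < ρ → ∀ x : EuclideanSpace ℝ (Fin 3), |x 2| < ρ → ∀ b : Fin 3, b ≠ 2 →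
      fderiv ℝ (U t) x (EuclideanSpace.single 2 1) b = μ t (x 2) * fderiv ℝ (U t) x (EuclideanSpace.single b 1) 2)
    (hδ'ρ : δ' ≤ ρ) (hδ'h : δ' < 1 / 2) (he2 : e 2 = 0) (hunit : e 0 ^ 2 + e 1 ^ 2 = 1)
    (hpack : ∀ q : ℝ × ℝ × ℝ, |q.1| < δ' → |q.2.2| < δ' →
        n₀ q ∈ Ioo (-r) r ∧
        σ * U (-1 + q.1) (frameCLM e (q.2.1, n₀ q, q.2.2)) 2 = R q.1 q.2.2 ∧
        (∀ n ∈ Icc (-r) r, n ≠ n₀ q → σ * U (-1 + q.1) (frameCLM e (q.2.1, n, q.2.2)) 2 < R q.1 q.2.2) ∧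
        (∀ w : EuclideanSpace ℝ (Fin 3), w 2 = 0 → fderiv ℝ (fun y => U (-1 + q.1) y 2) (frameCLM e (q.2.1, n₀ q, q.2.2)) w = 0) ∧
        (∀ m : ℕ∞, ContDiffAt ℝ m n₀ q) ∧
        0 < κt q.1 q.2.2 ∧
        fderiv ℝ (fderiv ℝ (fun y => σ * U (-1 + q.1) y 2)) (frameCLM e (q.2.1, n₀ q, q.2.2)) e e +
            fderiv ℝ (fderiv ℝ (fun y => σ * U (-1 + q.1) y 2)) (frameCLM e (q.2.1, n₀ q, q.2.2)) (Jvec e) (Jvec e) =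
          -κt q.1 q.2.2 ∧
        κt q.1 q.2.2 * (fderiv ℝ n₀ q ((0 : ℝ), (0 : ℝ), (1 : ℝ))) ^ 2 =
          (deriv (deriv (R q.1)) q.2.2 - μ (-1 + q.1) q.2.2 * κt q.1 q.2.2) * (1 + (fderiv ℝ n₀ q ((0 : ℝ), (1 : ℝ), (0 : ℝ))) ^ 2))
    (hδ' : 0 < δ')
    (hsonB : ∀ τ : ℝ, |τ| < δ' → ∃ A B : ℝ, ∀ z : ℝ, |z| < δ' → R τ z = A + B * z)
    (hparN : ∀ τ' s z : ℝ, |τ'| < δ' → |z| < δ' → n₀ (τ', s, z) = n₀ (τ', (0 : ℝ), z))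
    (hμnegB : ∀ τ z : ℝ, |τ| < δ' → |z| < δ' → μ (-1 + τ) z < 0) :
    ∃ τ₁ τ₂ : ℝ, -δ' ≤ τ₁ ∧ τ₁ < τ₂ ∧ τ₂ ≤ δ' ∧
      ((∀ τ ∈ Ioo τ₁ τ₂, ∀ s z : ℝ, |z| < δ' →
          ⟪fderiv ℝ (U (-1 + τ)) (frameCLM e (s, n₀ (τ, s, z), z)) e, e⟫ = 0 ∧
          ⟪fderiv ℝ (U (-1 + τ)) (frameCLM e (s, n₀ (τ, s, z), z)) e, Jvec e⟫ = 0) ∨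
       (∃ L : ℝ, 0 < L ∧ ∀ τ ∈ Ioo τ₁ τ₂, ∀ s z : ℝ, |z| < δ' →
          U (-1 + τ) (frameCLM e (s + L, n₀ (τ, s + L, z), z)) = U (-1 + τ) (frameCLM e (s, n₀ (τ, s, z), z)))) := by
  have h0 : |(0 : ℝ)| < δ' := by simpa using hδ'
  -- the dichotomy at every time of the box
  have hD := fun (τ : ℝ) (hτ : |τ| < δ') =>
    sheet_strain_dichotomy_of_package (κt := κt) hrate hcont hmild hdiv hpol hσ hμ3 hslabU hδ'ρ hδ'h he2 hunit hpack hτ (hsonB τ hτ) hparN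
      (fun z hz => hμnegB τ z hτ hz)
  have hn₀ : ∀ τ s : ℝ, |τ| < δ' → ContDiffAt ℝ ∞ n₀ (τ, s, (0 : ℝ)) := fun τ s hτ => (hpack (τ, s, (0 : ℝ)) hτ h0).2.2.2.2.1 ⊤
  -- the cross strain `K(τ, s) = S_eν(τ; s, 0)` (kept opaque)
  obtain ⟨K, hK_def⟩ : ∃ K : ℝ × ℝ → ℝ,
      K = fun p => ⟪fderiv ℝ (U (-1 + p.1)) (frameCLM e (p.2, n₀ (p.1, p.2, (0 : ℝ)), (0 : ℝ))) e, Jvec e⟫ := ⟨_, rfl⟩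
  have hKval : ∀ τ s : ℝ, K (τ, s) = ⟪fderiv ℝ (U (-1 + τ)) (frameCLM e (s, n₀ (τ, s, (0 : ℝ)), (0 : ℝ))) e, Jvec e⟫ := fun τ s => by
    rw [hK_def]
  -- LINK: `K(τ, ·)` is the `s`-derivative of the cross-web sheet function at height 0
  have hlink : ∀ τ : ℝ, |τ| < δ' → ∀ s : ℝ,
      HasDerivAt (fun s' : ℝ => ⟪U (-1 + τ) (frameCLM e (s', n₀ (τ, s', (0 : ℝ)), (0 : ℝ))), Jvec e⟫) (K (τ, s)) s := by
    intro τ hτ s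
    have ht : -1 + τ < 0 := by linarith [(abs_lt.1 (lt_trans hτ hδ'h)).2]
    obtain ⟨d, hd_def⟩ : ∃ d : ℝ → ℝ, d = fun z => n₀ (τ, (0 : ℝ), z) := ⟨_, rfl⟩
    have hWeq : ∀ s' : ℝ, frameCLM e (s', n₀ (τ, s', (0 : ℝ)), (0 : ℝ)) = webMap e (fun q : ℝ × ℝ => d q.2) (s', (0 : ℝ)) := by
      intro s'
      rw [frameCLM_apply, hparN τ s' 0 hτ h0, hd_def]
      rfl
    have hUd : Differentiable ℝ (U (-1 + τ)) :=
      ((analyticOnNhd_slice hcont (bdd_of_hasTypeITimeDecay hrate) hmild ht).contDiff (n := ∞)).differentiable (by simp)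
    have hdd : DifferentiableAt ℝ d 0 := by
      have h := (hn₀ τ 0 hτ).differentiableAt (by simp)
      rw [hd_def]
      exact h.comp (0 : ℝ) ((differentiableAt_const _).prodMk ((differentiableAt_const _).prodMk differentiableAt_id))
    obtain ⟨F₂, hF₂_def⟩ : ∃ F₂ : ℝ × ℝ → ℝ, F₂ = fun q => ⟪U (-1 + τ) (webMap e (fun q : ℝ × ℝ => d q.2) q), Jvec e⟫ := ⟨_, rfl⟩
    have hGd : DifferentiableAt ℝ (fun q : ℝ × ℝ => d q.2) (s, (0 : ℝ)) :=
      DifferentiableAt.comp (s, (0 : ℝ)) (hdd : DifferentiableAt ℝ d ((s, (0 : ℝ)) : ℝ × ℝ).2) differentiableAt_snd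
    have hF₂d : DifferentiableAt ℝ F₂ (s, (0 : ℝ)) := by
      rw [hF₂_def]
      exact ((hUd _).comp _ (hasFDerivAt_webMap e hGd).differentiableAt).inner ℝ (differentiableAt_const _)
    have h1 : HasDerivAt (fun s' : ℝ => F₂ (s', (0 : ℝ))) (fderiv ℝ F₂ (s, (0 : ℝ)) ((1 : ℝ), (0 : ℝ))) s := hasDerivAt_slice_fst (p := (s, (0 : ℝ))) hF₂d
    have h2 : fderiv ℝ F₂ (s, (0 : ℝ)) ((1 : ℝ), (0 : ℝ)) = K (τ, s) := by
      rw [hF₂_def, fderiv_sheetComponent (e := e) (d := d) (p := (s, (0 : ℝ))) hdd (hUd _) (Jvec e) ((1 : ℝ), (0 : ℝ))]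
      simp only [mul_zero, zero_mul, add_zero, one_mul]
      rw [hKval, hWeq s]
    have hfun : (fun s' : ℝ => F₂ (s', (0 : ℝ))) = fun s' => ⟪U (-1 + τ) (frameCLM e (s', n₀ (τ, s', (0 : ℝ)), (0 : ℝ))), Jvec e⟫ := by
      funext s'; rw [hF₂_def, hWeq s']
    rw [hfun, h2] at h1
    exact h1
  -- the trigonometric representation of `K(τ, ·)` in the oscillatory branch
  have hKrep : ∀ τ : ℝ, |τ| < δ' → ∀ (w : ℝ) (a₀' a₁' b₁' : ℝ → ℝ), 0 < w →
      (∀ s z : ℝ, |z| < δ' → ⟪U (-1 + τ) (frameCLM e (s, n₀ (τ, s, z), z)), Jvec e⟫ = a₀' z + a₁' z * Real.cos (w * s) + b₁' z * Real.sin (w * s)) →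
      ∀ s : ℝ, K (τ, s) = (b₁' 0 * w) * Real.cos (w * s) + (-(a₁' 0) * w) * Real.sin (w * s) := by
    intro τ hτ w a₀' a₁' b₁' _ hform s
    have h1 := hlink τ hτ s
    have hfun : (fun s' : ℝ => ⟪U (-1 + τ) (frameCLM e (s', n₀ (τ, s', (0 : ℝ)), (0 : ℝ))), Jvec e⟫) =
        fun s' => a₀' 0 + (a₁' 0 * Real.cos (w * s') + b₁' 0 * Real.sin (w * s')) := by
      funext s'; rw [hform s' 0 h0]; ring
    rw [hfun] at h1
    have h2 : HasDerivAt (fun s' : ℝ => a₀' 0 + (a₁' 0 * Real.cos (w * s') + b₁' 0 * Real.sin (w * s')))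
        (-(a₁' 0) * w * Real.sin (w * s) + b₁' 0 * w * Real.cos (w * s)) s := by
      have h := (trig_hasDerivAt (a₁' 0) (b₁' 0) w s).const_add (a₀' 0)
      exact h.congr_deriv (by ring)
    rw [h1.unique h2]; ring
  by_cases hall : ∀ τ : ℝ, |τ| < δ' → ∀ s z : ℝ, |z| < δ' →
      ⟪fderiv ℝ (U (-1 + τ)) (frameCLM e (s, n₀ (τ, s, z), z)) e, e⟫ = 0 ∧
        ⟪fderiv ℝ (U (-1 + τ)) (frameCLM e (s, n₀ (τ, s, z), z)) e, Jvec e⟫ = 0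
  · exact ⟨-δ', δ', le_rfl, by linarith, le_rfl, Or.inl fun τ hτ s z hz => hall τ (abs_lt.2 ⟨hτ.1, hτ.2⟩) s z hz⟩
  -- an oscillatory time `τ₀`
  obtain ⟨τ₀, hτ₀'⟩ := not_forall.1 hall
  obtain ⟨hτ₀, hnot⟩ := Classical.not_imp.1 hτ₀'
  have hosc₀ := hD τ₀ hτ₀
  rcases hosc₀ with hfree | ⟨w₀', hw₀', a₀, a₁, b₁, a₀', a₁', b₁', hnt, hform⟩
  · exact absurd hfree hnot
  have hKτ₀ := hKrep τ₀ hτ₀ w₀' a₀' a₁' b₁' hw₀' (fun s z hz => (hform s z hz).2)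
  obtain ⟨s₁, hs₁⟩ : ∃ s₁ : ℝ, K (τ₀, s₁) ≠ 0 := by
    rcases hnt 0 h0 with ha | hb
    · refine ⟨Real.pi / 2 / w₀', ?_⟩
      rw [hKτ₀]
      have : w₀' * (Real.pi / 2 / w₀') = Real.pi / 2 := by field_simp
      rw [this, Real.cos_pi_div_two, Real.sin_pi_div_two, mul_zero, zero_add, mul_one]
      exact mul_ne_zero (neg_ne_zero.2 ha) hw₀'.ne'
    · refine ⟨0, ?_⟩
      rw [hKτ₀]
      simp only [mul_zero, Real.cos_zero, Real.sin_zero, mul_one, add_zero]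
      exact mul_ne_zero hb hw₀'.ne'
  -- `K(·, s₁) ≠ 0` near `τ₀` (continuity), inside the box
  have hKK : ContDiffOn ℝ ∞ K (Prod.fst ⁻¹' Ioo (-δ') δ' : Set (ℝ × ℝ)) := by
    rw [hK_def]; exact crossStrain_contDiffOn (e := e) hrate hcont hmild hdiv hδ'h hn₀
  have hSo : IsOpen (Prod.fst ⁻¹' Ioo (-δ') δ' : Set (ℝ × ℝ)) := isOpen_strip isOpen_Ioo
  have hmem₀ : ((τ₀, s₁) : ℝ × ℝ) ∈ (Prod.fst ⁻¹' Ioo (-δ') δ' : Set (ℝ × ℝ)) := by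
    show τ₀ ∈ Ioo (-δ') δ'; exact ⟨by linarith [(abs_lt.1 hτ₀).1], (abs_lt.1 hτ₀).2⟩
  have hca : ContinuousAt (fun τ : ℝ => K (τ, s₁)) τ₀ := by
    have h1 : ContinuousAt K (τ₀, s₁) := (hKK.continuousOn.continuousWithinAt hmem₀).continuousAt (hSo.mem_nhds hmem₀)
    have h2 : ContinuousAt (fun τ : ℝ => ((τ, s₁) : ℝ × ℝ)) τ₀ := (continuous_id.prodMk continuous_const).continuousAt
    exact ContinuousAt.comp_of_eq h1 h2 rfl
  have hev : ∀ᶠ τ in 𝓝 τ₀, K (τ, s₁) ≠ 0 ∧ |τ| < δ' :=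
    (hca.eventually_ne hs₁).and ((isOpen_lt continuous_abs continuous_const).mem_nhds hτ₀)
  obtain ⟨ε, hε, hball⟩ := Metric.eventually_nhds_iff.1 hev
  set τ₁ : ℝ := max (τ₀ - ε) (-δ') with hτ₁
  set τ₂ : ℝ := min (τ₀ + ε) δ' with hτ₂
  have hτ₀lt : -δ' < τ₀ ∧ τ₀ < δ' := ⟨by linarith [(abs_lt.1 hτ₀).1], (abs_lt.1 hτ₀).2⟩
  have hτ₁₂ : τ₁ < τ₂ := by
    rw [hτ₁, hτ₂]
    exact max_lt (lt_min (by linarith) (by linarith [hτ₀lt.2])) (lt_min (by linarith [hτ₀lt.1]) (by linarith))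
  have hJ : ∀ τ ∈ Ioo τ₁ τ₂, K (τ, s₁) ≠ 0 ∧ |τ| < δ' := by
    intro τ hτ
    rw [hτ₁, hτ₂, mem_Ioo, max_lt_iff, lt_min_iff] at hτ
    exact hball (by rw [Real.dist_eq]; exact abs_lt.2 ⟨by linarith [hτ.1.1], by linarith [hτ.2.1]⟩)
  -- one frequency on `J`
  have hJo : IsOpen (Ioo τ₁ τ₂) := isOpen_Ioo
  have hKJ : ContDiffOn ℝ ∞ K (Prod.fst ⁻¹' Ioo τ₁ τ₂ : Set (ℝ × ℝ)) := by
    refine hKK.mono fun p hp => ?_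
    have h := (hJ p.1 hp).2
    show p.1 ∈ Ioo (-δ') δ'; exact ⟨by linarith [(abs_lt.1 h).1], (abs_lt.1 h).2⟩
  have htrig : ∀ τ ∈ Ioo τ₁ τ₂, ∃ w a b : ℝ, 0 < w ∧ ∀ s, K (τ, s) = a * Real.cos (w * s) + b * Real.sin (w * s) := by
    intro τ hτ
    obtain ⟨hne, hτa⟩ := hJ τ hτ
    rcases hD τ hτa with hfree | ⟨w, hw, c₀, c₁, c₂, c₀', c₁', c₂', -, hformτ⟩
    · exact absurd ((hKval τ s₁).trans (hfree s₁ 0 h0).2) hne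
    · exact ⟨w, c₂' 0 * w, -(c₁' 0) * w, hw, hKrep τ hτa w c₀' c₁' c₂' hw (fun s z hz => (hformτ s z hz).2)⟩
  have hneJ : ∀ τ ∈ Ioo τ₁ τ₂, K (τ, s₁) ≠ 0 := fun τ hτ => (hJ τ hτ).1
  have hlipJ : ∀ τ ∈ Ioo τ₁ τ₂, ∃ M : ℝ, 0 ≤ M ∧ ∀ s : ℝ, ∀ᶠ τ' in 𝓝 τ, |K (τ', s) - K (τ, s)| ≤ M * |τ' - τ| := by
    intro τ hτ
    obtain ⟨M, hM, hlip⟩ := crossStrain_lipschitz (e := e) hrate hcont hmild hdiv hδ'h hparN hn₀ (hJ τ hτ).2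
    refine ⟨M, hM, fun s => ?_⟩
    filter_upwards [hlip s] with τ' hτ'
    rw [hKval, hKval]; exact hτ'
  obtain ⟨w₀, hw₀, hlock⟩ := locked_frequency hJo isPreconnected_Ioo hKJ htrig hneJ hlipJ
  have hσ0 : σ ≠ 0 := by rcases hσ with h | h <;> simp [h]
  refine ⟨τ₁, τ₂, le_max_right _ _, hτ₁₂, min_le_right _ _, Or.inr ⟨2 * Real.pi / w₀, by positivity, fun τ hτ s z hz => ?_⟩⟩
  obtain ⟨hne, hτa⟩ := hJ τ hτ
  rcases hD τ hτa with hfree | ⟨w, hw, c₀, c₁, c₂, c₀', c₁', c₂', -, hformτ⟩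
  · exact absurd ((hKval τ s₁).trans (hfree s₁ 0 h0).2) hne
  have hw0 : w = w₀ := hlock τ hτ w (c₂' 0 * w) (-(c₁' 0) * w) hw (hKrep τ hτa w c₀' c₁' c₂' hw (fun s z hz => (hformτ s z hz).2))
  have harg : w * (s + 2 * Real.pi / w₀) = w * s + 2 * Real.pi := by rw [← hw0]; field_simp
  have hper1 : ⟪U (-1 + τ) (frameCLM e (s + 2 * Real.pi / w₀, n₀ (τ, s + 2 * Real.pi / w₀, z), z)), e⟫ =
      ⟪U (-1 + τ) (frameCLM e (s, n₀ (τ, s, z), z)), e⟫ := by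
    rw [(hformτ (s + 2 * Real.pi / w₀) z hz).1, (hformτ s z hz).1, harg, Real.cos_add_two_pi, Real.sin_add_two_pi]
  have hper2 : ⟪U (-1 + τ) (frameCLM e (s + 2 * Real.pi / w₀, n₀ (τ, s + 2 * Real.pi / w₀, z), z)), Jvec e⟫ =
      ⟪U (-1 + τ) (frameCLM e (s, n₀ (τ, s, z), z)), Jvec e⟫ := by
    rw [(hformτ (s + 2 * Real.pi / w₀) z hz).2, (hformτ s z hz).2, harg, Real.cos_add_two_pi, Real.sin_add_two_pi]
  have hper3 : U (-1 + τ) (frameCLM e (s + 2 * Real.pi / w₀, n₀ (τ, s + 2 * Real.pi / w₀, z), z)) 2 =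
      U (-1 + τ) (frameCLM e (s, n₀ (τ, s, z), z)) 2 := by
    have h1 := (hpack (τ, s + 2 * Real.pi / w₀, z) hτa hz).2.1
    have h2 := (hpack (τ, s, z) hτa hz).2.1
    simp only at h1 h2
    exact mul_left_cancel₀ hσ0 (h1.trans h2.symm)
  exact eq_of_frame_components he2 hunit hper1 hper2 hper3

end Summit.NavierStokesRegularity.NavierStokesRegularity.Theorems.PoloidalWindowDoorLrcModEntireSonicSheetStrainWindow

end
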